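/-
Copyright (c) 2026 the pub-hodgecm-mathlib formalisation cell (harness21).  Prover seat hodgecm-mathlib-K2E3-p14 (g10) (E3 hand on strike line L1; LEAD F0P6-plan (g15)
BATCH #251 (a) follow-on, default offer 02:11:56Z (i)), Track B «K2-LIT» ∕ hLiu418 = `stmt-HodgeConjecture-24832`: U1-glob LEVEL 2-fin, the ARCH-KERNEL branch — the U1 TIE
ADAPTER: ★ (α)-Σ p864470's arch reading letter ASSEMBLED from the three presentation letters of the shared core (★ p864502, LH4-p17 (g3)) kept in their generic currency.
THEOREMS ONLY (no `def` ∕ `instance` ∕ notation ∕ named-fact hypothesis ∕ `sorry`).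
-/
import Summits.HodgeConjecture.HodgeConjecture.Theorems.K2LiuLocalKernelArchPresentationScalarType   -- ★ (α)-Σ p864470 (this seat): `exists_continuation_of_frameTensorSum` (+ ★ p864419, ★ p864260, ★ C131-p02)
import HarnessLib

/-!
# Crux `HLiu418`, U1-glob LEVEL 2-fin, arch-kernel branch — `K2LiuLocalKernelArchReadingOfLetters`: THE U1 TIE ADAPTER — (F-arch)'s arch reading `(Ainfc, hAinfc, hAinf)` FROM THE
# PRESENTATION LETTERS (E) character-through-frame, (M)+(T) flat-tube presentation of the section at the translated point, per-term integrability, per-place local continuations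

Cell `hodgecm-mathlib`, crux item hLiu418 = `stmt-HodgeConjecture-24832`; squad K2, strike line L1, LEAD F0P6-plan (g15); U1 desk K2E3-p28 (g4); END pen K2E3-p32 (g3) (FILE B-arch
★ p864406 + adapters ★ p864487 ∕ p864523); shared presentation core LH4-p17 (g3) ★ p864502 `K2LiuIncoherentRankOneArchPlacePresentation`.  Lane `--supports stmt-HodgeConjecture-24832
--as helper` (count-neutral).  THEOREMS ONLY.

THE POINT.  ★ (α)-Σ `K2LiuLocalKernelArchPresentationScalarType.hloc_archLetters_of_frameTensorSum` continues the arch block of ★ FILE 4's `hloc` from ONE by-value letter `hsum` — the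
integrand `conj ψ_S(u_∞)·bA_s((w_Δ)_∞ u h_∞)` written as a finite sum `Σ_r γ_r(s)·∏_w Ψloc r w s (Fr u w)` of frame-pure terms.  The shared core (★ p864502, block-D currency, fully
generic in its types) builds such sums from THREE letters of record: (E) the character read through the frame, `conj ψ_S(ι_∞ u) = ∏_w eb w (blk (FrΩ u w))` (★
`K2LiuKindWArchCharacterFrameReading.conj_unipDeltaChar_archToAdelic_eq_prod`); (M) the frame is multiplicative, `Fr((w_Δ)_∞ u h_∞) w = Frx w · FrΩ u w · Frg w` (★ `frame_mul`); (T) the flat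
tube presentation of the section at the framed translated point, `bA_s((w_Δ)_∞ u h_∞) = Σ_{r∈R} γ_r(s)·∏_w Fs r w s (Frx w · FrΩ u w · Frg w)` (★ `exists_flat_tube_presentation`, the
`s`-dependent height scalar pulled into `γ_r`).  THIS FILE is the U1-side adapter: from (E), (M)+(T) (stated directly at the product `Frx w · FrΩ u w · Frg w`), the per-term
integrability `hint` and the per-`(r, w)` local continuation clauses `hAloc` for the EXPLICIT local integrand `eb w (blk m) · Fs r w s (Frx w · m · Frg w)` — `γ_r` kept OUTSIDE the place
product (no `w₀`-folding on the U1 side: ★ p864470 carries `γ_r` separately) — it assembles `hsum` (`Finset.prod_mul_distrib`) and returns ★ (F-arch)'s `(Ainfc, hAinfc, hAinf)` with the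
Σ-witness; `hloc_archLetters_of_presentationLetters_exists` takes the transport letter in ★ `exists_integral_frame_eq_smul`'s `∃ c`-form.
* §1 `integrand_eq_sum_frameTensor` — (E) + (T) ⟹ `hsum` with `Ψloc r w s m := eb w (blk m) · Fs r w s (Frx w · m · Frg w)`.
* §2 **`hloc_archLetters_of_presentationLetters`**, **`hloc_archLetters_of_presentationLetters_exists`**.
References: [KudlaRallis1994] §2 (2.10)–(2.12); [HarrisKudlaSweet1996] §1 (1.15)–(1.17); [Tate1967] §3 Thm. 3.3.1; [BorelJacquet1979] §4.1; [Shimura1982] §4 Thm. 4.2.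
HONEST LABEL.  Count-neutral composition: `HC_CM` is proved only modulo the 7 printed citations (2 remaining named inputs: hLiu418 = `stmt-HodgeConjecture-24832`,
h413 = `stmt-HodgeConjecture-24833`) until rung 0 closes; U1-glob LEVEL 2 stays OPEN ((E)(M)(T) ★ readings instantiated at the record by FILE B-arch's pen; `hint`; `hAloc`; `hdead∞` = (σ-A)).
-/

set_option autoImplicit false
set_option linter.dupNamespace false -- the mandated namespace repeats `HodgeConjecture.HodgeConjecture`

noncomputable section

open scoped Matrix NNReal ComplexOrder ComplexConjugate
open Complex MeasureTheory Matrix NumberField NumberField.InfinitePlace IsDedekindDomain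
open Literature.NumberTheory.Automorphic Literature.NumberTheory.Automorphic.UnitaryGroup Literature.NumberTheory.GaloisRepresentations
open Literature.NumberTheory.GelbartRogawski1991 Literature.NumberTheory.GelbartRogawski1991.GRConstruction
open Literature.NumberTheory.K2Lit.SiegelDoubled

namespace Summit.HodgeConjecture.HodgeConjecture.Cruxes.HLiu418.K2LiuLocalKernelArchReadingOfLetters

open K2LiuSiegelUnipotentFourierDefs
open K2LiuSiegelUnipotentLocalDefs
open K2LiuLocalKernelArchPresentationScalarType (exists_continuation_of_frameTensorSum)

/-! ## §1 (E) + (T): the integrand as a finite sum of frame-pure terms -/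

/-- **(E) + (T) ⟹ `hsum`.**  A weight that is a pure tensor through the frame, `χ u = ∏_w eb w (blk (FrΩ u w))`, times a section presented as `Σ_{r∈R} γ_r · ∏_w Fs r w (Frx w · FrΩ u w · Frg w)`,
is the finite sum `Σ_{r∈R} γ_r · ∏_w (eb w (blk (FrΩ u w)) · Fs r w (Frx w · FrΩ u w · Frg w))` (`Finset.mul_sum`, `Finset.prod_mul_distrib`). [cite: Tate1967, §3 Thm. 3.3.1] [cite: BorelJacquet1979, §4.1] -/
theorem integrand_eq_sum_frameTensor {Ω σ Mfr B ρ : Type*} [Fintype σ] [Mul Mfr] (FrΩ : Ω → σ → Mfr) (Frx Frg : σ → Mfr) (blk : Mfr → B)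
    (χ : Ω → ℂ) (eb : σ → B → ℂ) (heb : ∀ u, χ u = ∏ w, eb w (blk (FrΩ u w)))
    (R : Finset ρ) (γ : ρ → ℂ) (Fs : ρ → σ → Mfr → ℂ) (Φ : Ω → ℂ)
    (hpres : ∀ u, Φ u = ∑ r ∈ R, γ r * ∏ w, Fs r w (Frx w * FrΩ u w * Frg w)) (u : Ω) :
    χ u * Φ u = ∑ r ∈ R, γ r * ∏ w, (eb w (blk (FrΩ u w)) * Fs r w (Frx w * FrΩ u w * Frg w)) := by
  rw [heb u, hpres u, Finset.mul_sum]
  refine Finset.sum_congr rfl fun r _ => ?_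
  rw [Finset.prod_mul_distrib]
  ring

/-! ## §2 At the K2_Liu frame: (F-arch)'s arch reading from the presentation letters -/

section Frame

variable (L : Type) [Field L] [NumberField L] [IsCMField L]
variable {N M n : ℕ} (e : Fin N × Fin M ≃ Fin n)
  (dV : Fin N → L) (hdV : ∀ i, IsCMField.complexConj L (dV i) = dV i)
  (dW : Fin M → L) (hdW : ∀ i, IsCMField.complexConj L (dW i) = dW i)

/-- **THE U1 TIE ADAPTER — (F-arch)'s `(Ainfc, hAinfc, hAinf)` FROM THE PRESENTATION LETTERS.**  For the block `A∞ s = ∫ conj ψ_S(u_∞)·bA_s((w_Δ)_∞ u h_∞) dν_∞` of ★ FILE 4's `hloc`: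
BY VALUE the transport letter `htrans` through a frame `(FrΩ, nfr, c)` (★ `exists_integral_frame_eq_smul` at `ν_∞`); (E) `heb` the Siegel character at the rank-one index `S` read
through the frame (★ `conj_unipDeltaChar_archToAdelic_eq_prod`); (T)+(M) `hpres` the flat tube presentation of `bA_s` at the framed translated point `Frx w · FrΩ u w · Frg w` with
holomorphic scalars `γ_r` (★ `exists_flat_tube_presentation` ∘ ★ `frame_mul`); per-term integrability `hint`; per-`(r,w)` local continuation clauses `hAloc` for the explicit local integrand
`eb w (blk m) · Fs r w s (Frx w · m · Frg w)` (★ (α)-Σ §0 at scalar type ∕ ★ (D-arch-loc) letters).  THEN `∃ Ainfc` holomorphic on `{0 < re}` with `A∞ s = Ainfc s` on `{1 < re}` and the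
WITNESS `Ainfc s = Σ_{r∈R} γ_r(s) · (c · ∏_w E r w s)`, every `E r w` holomorphic on `{0 < re}` and `= ∫ eb w (blk (nfr w ρ)) · Fs r w s (Frx w · nfr w ρ · Frg w) dρ` on `{½ < re}`.
[cite: KudlaRallis1994, §2 (2.10)–(2.12)] [cite: HarrisKudlaSweet1996, §1 (1.15)–(1.17)] [cite: Tate1967, §3 Thm. 3.3.1] [cite: Shimura1982, §4 Thm. 4.2] -/
theorem hloc_archLetters_of_presentationLetters [Fintype {w : InfinitePlace L // w.IsComplex}] [MeasurableSpace ↥(unipDeltaArch L e dV hdV dW hdW)]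
    (νinf : Measure ↥(unipDeltaArch L e dV hdV dW hdW)) (S : Matrix (Fin n) (Fin n) L) (h : HA L e dV hdV dW hdW) (bA : ℂ → UnitaryGroup.arch (Fp L) L (IsCMField.complexConj L) (n + n) (hermD L e dV hdV dW hdW) → ℂ)
    -- the frame of the unipotent with local coordinates and the transport letter (BY VALUE)
    {Mfr B : Type*} [Mul Mfr] (FrΩ : ↥(unipDeltaArch L e dV hdV dW hdW) → {w : InfinitePlace L // w.IsComplex} → Mfr) (nfr : {w : InfinitePlace L // w.IsComplex} → (Fin 2 → Fin 2 → ℝ) → Mfr) (c : ℝ≥0)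
    (htrans : ∀ Ψ : ({w : InfinitePlace L // w.IsComplex} → Mfr) → ℂ, ∫ u, Ψ (FrΩ u) ∂νinf = c • ∫ r : {w : InfinitePlace L // w.IsComplex} → (Fin 2 → Fin 2 → ℝ), Ψ (fun w => nfr w (r w)))
    -- (E) the character read through the frame
    (blk : Mfr → B) (eb : {w : InfinitePlace L // w.IsComplex} → B → ℂ)
    (heb : ∀ u : ↥(unipDeltaArch L e dV hdV dW hdW),
      (conj (unipDeltaChar L e dV hdV dW hdW S (UnitaryGroup.archToAdelic (Fp L) L (IsCMField.complexConj L) (n + n) (hermD L e dV hdV dW hdW) (u : UnitaryGroup.arch (Fp L) L (IsCMField.complexConj L) (n + n) (hermD L e dV hdV dW hdW))) : ℂ) : ℂ) = ∏ w, eb w (blk (FrΩ u w)))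
    -- (M)+(T) the frames of `(w_Δ)_∞` and `h_∞` and the flat tube presentation of the section at the framed translated point
    (Frx Frg : {w : InfinitePlace L // w.IsComplex} → Mfr) {ρ : Type*} (R : Finset ρ) (γ : ρ → ℂ → ℂ) (hγ : ∀ r ∈ R, DifferentiableOn ℂ (γ r) {s : ℂ | 0 < s.re})
    (Fs : ρ → {w : InfinitePlace L // w.IsComplex} → ℂ → Mfr → ℂ)
    (hpres : ∀ (s : ℂ) (u : ↥(unipDeltaArch L e dV hdV dW hdW)),
      bA s (UnitaryGroup.archPart (Fp L) L (IsCMField.complexConj L) (n + n) (hermD L e dV hdV dW hdW) (weylDelta L e dV hdV dW hdW) * (u : UnitaryGroup.arch (Fp L) L (IsCMField.complexConj L) (n + n) (hermD L e dV hdV dW hdW)) * UnitaryGroup.archPart (Fp L) L (IsCMField.complexConj L) (n + n) (hermD L e dV hdV dW hdW) h) =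
        ∑ r ∈ R, γ r s * ∏ w, Fs r w s (Frx w * FrΩ u w * Frg w))
    -- per-term integrability and per-place local continuation (BY VALUE)
    (hint : ∀ r ∈ R, ∀ s : ℂ, 1 / 2 < s.re →
      Integrable (fun u : ↥(unipDeltaArch L e dV hdV dW hdW) => ∏ w, (eb w (blk (FrΩ u w)) * Fs r w s (Frx w * FrΩ u w * Frg w))) νinf)
    (hAloc : ∀ r ∈ R, ∀ w : {w : InfinitePlace L // w.IsComplex}, ∃ E : ℂ → ℂ, DifferentiableOn ℂ E {s : ℂ | 0 < s.re} ∧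
      ∀ s : ℂ, 1 / 2 < s.re → ∫ ρ' : Fin 2 → Fin 2 → ℝ, eb w (blk (nfr w ρ')) * Fs r w s (Frx w * nfr w ρ' * Frg w) = E s) :
    ∃ Ainfc : ℂ → ℂ, DifferentiableOn ℂ Ainfc {s : ℂ | 0 < s.re} ∧
      (∀ s : ℂ, 1 < s.re →
        (∫ u, conj (unipDeltaChar L e dV hdV dW hdW S (UnitaryGroup.archToAdelic (Fp L) L (IsCMField.complexConj L) (n + n) (hermD L e dV hdV dW hdW) (u : UnitaryGroup.arch (Fp L) L (IsCMField.complexConj L) (n + n) (hermD L e dV hdV dW hdW))) : ℂ) *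
            bA s (UnitaryGroup.archPart (Fp L) L (IsCMField.complexConj L) (n + n) (hermD L e dV hdV dW hdW) (weylDelta L e dV hdV dW hdW) * (u : UnitaryGroup.arch (Fp L) L (IsCMField.complexConj L) (n + n) (hermD L e dV hdV dW hdW)) * UnitaryGroup.archPart (Fp L) L (IsCMField.complexConj L) (n + n) (hermD L e dV hdV dW hdW) h) ∂νinf) = Ainfc s) ∧
      ∃ E : ρ → {w : InfinitePlace L // w.IsComplex} → ℂ → ℂ,
        (∀ r ∈ R, ∀ w, DifferentiableOn ℂ (E r w) {s : ℂ | 0 < s.re}) ∧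
        (∀ r ∈ R, ∀ (w : {w : InfinitePlace L // w.IsComplex}) (s : ℂ), 1 / 2 < s.re →
          ∫ ρ' : Fin 2 → Fin 2 → ℝ, eb w (blk (nfr w ρ')) * Fs r w s (Frx w * nfr w ρ' * Frg w) = E r w s) ∧
        ∀ s : ℂ, Ainfc s = ∑ r ∈ R, γ r s * (((c : ℝ) : ℂ) * ∏ w, E r w s) := by
  -- `hsum` by §1, then ★ (α)-Σ §1 with `Ψloc r w s m := eb w (blk m) · Fs r w s (Frx w · m · Frg w)`
  have hsum : ∀ (s : ℂ) (u : ↥(unipDeltaArch L e dV hdV dW hdW)),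
      conj (unipDeltaChar L e dV hdV dW hdW S (UnitaryGroup.archToAdelic (Fp L) L (IsCMField.complexConj L) (n + n) (hermD L e dV hdV dW hdW) (u : UnitaryGroup.arch (Fp L) L (IsCMField.complexConj L) (n + n) (hermD L e dV hdV dW hdW))) : ℂ) *
            bA s (UnitaryGroup.archPart (Fp L) L (IsCMField.complexConj L) (n + n) (hermD L e dV hdV dW hdW) (weylDelta L e dV hdV dW hdW) * (u : UnitaryGroup.arch (Fp L) L (IsCMField.complexConj L) (n + n) (hermD L e dV hdV dW hdW)) * UnitaryGroup.archPart (Fp L) L (IsCMField.complexConj L) (n + n) (hermD L e dV hdV dW hdW) h) =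
        ∑ r ∈ R, γ r s * ∏ w, (fun r w s (m : Mfr) => eb w (blk m) * Fs r w s (Frx w * m * Frg w)) r w s (FrΩ u w) :=
    fun s u => integrand_eq_sum_frameTensor FrΩ Frx Frg blk _ eb heb R (fun r => γ r s) (fun r w m => Fs r w s m) _ (hpres s) u
  obtain ⟨E, hEd, hEeq, hdiff, hval⟩ := exists_continuation_of_frameTensorSum νinf FrΩ nfr c htrans R
    (fun s u => conj (unipDeltaChar L e dV hdV dW hdW S (UnitaryGroup.archToAdelic (Fp L) L (IsCMField.complexConj L) (n + n) (hermD L e dV hdV dW hdW) (u : UnitaryGroup.arch (Fp L) L (IsCMField.complexConj L) (n + n) (hermD L e dV hdV dW hdW))) : ℂ) *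
            bA s (UnitaryGroup.archPart (Fp L) L (IsCMField.complexConj L) (n + n) (hermD L e dV hdV dW hdW) (weylDelta L e dV hdV dW hdW) * (u : UnitaryGroup.arch (Fp L) L (IsCMField.complexConj L) (n + n) (hermD L e dV hdV dW hdW)) * UnitaryGroup.archPart (Fp L) L (IsCMField.complexConj L) (n + n) (hermD L e dV hdV dW hdW) h))
    γ hγ (fun r w s (m : Mfr) => eb w (blk m) * Fs r w s (Frx w * m * Frg w)) hsum hint hAloc
  exact ⟨fun s => ∑ r ∈ R, γ r s * (((c : ℝ) : ℂ) * ∏ w, E r w s), hdiff, fun s hs => hval s (by linarith), E, hEd, hEeq, fun s => rfl⟩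

/-- **… WITH THE TRANSPORT LETTER IN `∃ c`-FORM** (★ `exists_integral_frame_eq_smul`'s conclusion per measure; the constant is then hidden in the witness).
[cite: Folland1995, §2.2] [cite: KudlaRallis1994, §2 (2.10)–(2.12)] -/
theorem hloc_archLetters_of_presentationLetters_exists [Fintype {w : InfinitePlace L // w.IsComplex}] [MeasurableSpace ↥(unipDeltaArch L e dV hdV dW hdW)]
    (νinf : Measure ↥(unipDeltaArch L e dV hdV dW hdW)) (S : Matrix (Fin n) (Fin n) L) (h : HA L e dV hdV dW hdW) (bA : ℂ → UnitaryGroup.arch (Fp L) L (IsCMField.complexConj L) (n + n) (hermD L e dV hdV dW hdW) → ℂ)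
    {Mfr B : Type*} [Mul Mfr] (FrΩ : ↥(unipDeltaArch L e dV hdV dW hdW) → {w : InfinitePlace L // w.IsComplex} → Mfr) (nfr : {w : InfinitePlace L // w.IsComplex} → (Fin 2 → Fin 2 → ℝ) → Mfr)
    (htransE : ∃ c : ℝ≥0, ∀ Ψ : ({w : InfinitePlace L // w.IsComplex} → Mfr) → ℂ, ∫ u, Ψ (FrΩ u) ∂νinf = c • ∫ r : {w : InfinitePlace L // w.IsComplex} → (Fin 2 → Fin 2 → ℝ), Ψ (fun w => nfr w (r w)))
    (blk : Mfr → B) (eb : {w : InfinitePlace L // w.IsComplex} → B → ℂ)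
    (heb : ∀ u : ↥(unipDeltaArch L e dV hdV dW hdW),
      (conj (unipDeltaChar L e dV hdV dW hdW S (UnitaryGroup.archToAdelic (Fp L) L (IsCMField.complexConj L) (n + n) (hermD L e dV hdV dW hdW) (u : UnitaryGroup.arch (Fp L) L (IsCMField.complexConj L) (n + n) (hermD L e dV hdV dW hdW))) : ℂ) : ℂ) = ∏ w, eb w (blk (FrΩ u w)))
    (Frx Frg : {w : InfinitePlace L // w.IsComplex} → Mfr) {ρ : Type*} (R : Finset ρ) (γ : ρ → ℂ → ℂ) (hγ : ∀ r ∈ R, DifferentiableOn ℂ (γ r) {s : ℂ | 0 < s.re})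
    (Fs : ρ → {w : InfinitePlace L // w.IsComplex} → ℂ → Mfr → ℂ)
    (hpres : ∀ (s : ℂ) (u : ↥(unipDeltaArch L e dV hdV dW hdW)),
      bA s (UnitaryGroup.archPart (Fp L) L (IsCMField.complexConj L) (n + n) (hermD L e dV hdV dW hdW) (weylDelta L e dV hdV dW hdW) * (u : UnitaryGroup.arch (Fp L) L (IsCMField.complexConj L) (n + n) (hermD L e dV hdV dW hdW)) * UnitaryGroup.archPart (Fp L) L (IsCMField.complexConj L) (n + n) (hermD L e dV hdV dW hdW) h) =
        ∑ r ∈ R, γ r s * ∏ w, Fs r w s (Frx w * FrΩ u w * Frg w))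
    (hint : ∀ r ∈ R, ∀ s : ℂ, 1 / 2 < s.re →
      Integrable (fun u : ↥(unipDeltaArch L e dV hdV dW hdW) => ∏ w, (eb w (blk (FrΩ u w)) * Fs r w s (Frx w * FrΩ u w * Frg w))) νinf)
    (hAloc : ∀ r ∈ R, ∀ w : {w : InfinitePlace L // w.IsComplex}, ∃ E : ℂ → ℂ, DifferentiableOn ℂ E {s : ℂ | 0 < s.re} ∧
      ∀ s : ℂ, 1 / 2 < s.re → ∫ ρ' : Fin 2 → Fin 2 → ℝ, eb w (blk (nfr w ρ')) * Fs r w s (Frx w * nfr w ρ' * Frg w) = E s) :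
    ∃ Ainfc : ℂ → ℂ, DifferentiableOn ℂ Ainfc {s : ℂ | 0 < s.re} ∧
      (∀ s : ℂ, 1 < s.re →
        (∫ u, conj (unipDeltaChar L e dV hdV dW hdW S (UnitaryGroup.archToAdelic (Fp L) L (IsCMField.complexConj L) (n + n) (hermD L e dV hdV dW hdW) (u : UnitaryGroup.arch (Fp L) L (IsCMField.complexConj L) (n + n) (hermD L e dV hdV dW hdW))) : ℂ) *
            bA s (UnitaryGroup.archPart (Fp L) L (IsCMField.complexConj L) (n + n) (hermD L e dV hdV dW hdW) (weylDelta L e dV hdV dW hdW) * (u : UnitaryGroup.arch (Fp L) L (IsCMField.complexConj L) (n + n) (hermD L e dV hdV dW hdW)) * UnitaryGroup.archPart (Fp L) L (IsCMField.complexConj L) (n + n) (hermD L e dV hdV dW hdW) h) ∂νinf) = Ainfc s) ∧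
      ∃ (c : ℝ≥0) (E : ρ → {w : InfinitePlace L // w.IsComplex} → ℂ → ℂ),
        (∀ r ∈ R, ∀ w, DifferentiableOn ℂ (E r w) {s : ℂ | 0 < s.re}) ∧
        (∀ r ∈ R, ∀ (w : {w : InfinitePlace L // w.IsComplex}) (s : ℂ), 1 / 2 < s.re →
          ∫ ρ' : Fin 2 → Fin 2 → ℝ, eb w (blk (nfr w ρ')) * Fs r w s (Frx w * nfr w ρ' * Frg w) = E r w s) ∧
        ∀ s : ℂ, Ainfc s = ∑ r ∈ R, γ r s * (((c : ℝ) : ℂ) * ∏ w, E r w s) := by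
  obtain ⟨c, htrans⟩ := htransE
  obtain ⟨Ainfc, hAinfc, hAinf, E, hEd, hEeq, hw⟩ := hloc_archLetters_of_presentationLetters L e dV hdV dW hdW νinf S h bA FrΩ nfr c htrans blk eb heb Frx Frg R γ hγ Fs
    hpres hint hAloc
  exact ⟨Ainfc, hAinfc, hAinf, c, E, hEd, hEeq, hw⟩

end Frame

end Summit.HodgeConjecture.HodgeConjecture.Cruxes.HLiu418.K2LiuLocalKernelArchReadingOfLetters

end
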